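import Summits.ResolutionOfSingularities.ResolutionOfSingularities.Theorems.FrobeniusLadderFInjectiveMacaulayficationDimLe4Reduced
import Summits.ResolutionOfSingularities.ResolutionOfSingularities.Theorems.FrobeniusLadderFInjectiveMacaulayficationFTemkinClosedPointsFibre
import Summits.ResolutionOfSingularities.ResolutionOfSingularities.Theorems.FrobeniusLadderFInjectiveMacaulayficationLocalFullificationDimFourFibre
import HarnessLib

/-!
# THE DIM-4 SLICE OF THE CRUX ⟸ Cossart–Piltant package ∧ (L4♭) — integral form and the crux's own ∀-text on `dim X ≤ 4`
# (crux `FInjectiveMacaulayfication` stmt-ResolutionOfSingularities-15315, chain w45a; res-L1-w45a-plan-1 RULING R17.1 §4 «REFINEMENT OF RECORD»: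
# the (L4) chain p584097 → p584558 → p585410 re-run on the WEAKER fibre-supported local statement (L4♭) `LocalFullificationDimFourFibre`;
# seat res-L1-w45a-stub-2 g6)

[OURS · L1 W4.5a] Support file (`--supports stmt-ResolutionOfSingularities-15315 --as helper`); replaces the role of NO printed item; NOT a statement of
the manuscript; def-free; THEOREMS modulo `CossartPiltant2019General` (CP 2019 Thm. 1.1 (i)(ii)), `Stacks081R` (Raynaud–Gruson 5.2.2),
`CossartPiltant2019Principalization` (CP 2019 Prop. 4.4) BY NAME and modulo the CANDIDATE (L4♭)
`LocalFullificationDimFourFibre.LocalFullificationDimFourFibre` of OURS (this seat; conjecture-tagged, consumed as a hypothesis only); AI-written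
(AI review is weaker than expert review).

* `fiModel_integral_dimLe4_of_L4fibre (hG h081R hP) (hL4 : LocalFullificationDimFourFibre)` — every integral separated `k`-variety of dimension
  `≤ 4` has a proper birational INTEGRAL model all of whose local rings are FULL (= RHS of `Reductions.fInjectiveMacaulayfication_iff_integral`):
  res-L1-w45a-lead-1's `FInjectiveMacaulayficationDimFour.fiModel_integral_dimLe4_of_step` (p584445; `dim ≤ 3` CP outright, `dim = 4` THEOREM A(4))
  with its F-Temkin hypothesis `hii` supplied by this seat's `FTemkinClosedPointsFibre.full_model_of_regularOffFinite_of_L4fibre`.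
* `exists_fiModel_dimLe4_of_L4fibre` / **`fInjectiveMacaulayfication_dimLe4_of_L4fibre (hG h081R hP) (hL4)`** — the ∀-text of the route's crux
  `Summit.ResolutionOfSingularities.ResolutionOfSingularities.Theses.FrobeniusLadder.FInjectiveMacaulayfication` VERBATIM with ONE extra binder
  `topologicalKrullDim X ≤ 4` (reduced `X`), by the door's component gluing exactly as in res-L1-w45a-stub-3's `DimLe4Reduced` (p585410).
(The (L4) version, res-L1-w45a-stub-3's `DimLe4Reduced.fInjectiveMacaulayfication_dimLe4_of_L4` p585410, is the special case through
`LocalFullificationDimFourFibre.localFullificationDimFourFibre_of_localFullificationDimFour` — not restated.)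
Upshot: **crux|_{dim X ≤ 4} ⟸ {CP 1.1, R–G 081R, CP 4.4} ∧ (L4♭)**, with (L4♭) ≤ (L4) as registered residues.
[folklore assembly; cite: CossartPiltant2019, Thm. 1.1 (i)(ii); Prop. 4.4] [cite: RaynaudGruson1971, Thm. 5.2.2] [cite: Temkin2008, Prop. 2.3.4; Lemma 2.1.1]
-/

-- single-problem summit: the doubled namespace component is forced
set_option linter.dupNamespace false

noncomputable section

namespace Summit.ResolutionOfSingularities.ResolutionOfSingularities.Theorems.FInjectiveMacaulayfication.DimLe4OfL4Fibre

open CategoryTheory CategoryTheory.Limits AlgebraicGeometry TopologicalSpace IsLocalRing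
open Literature.AlgebraicGeometry.Resolution
open Summit.ResolutionOfSingularities.ResolutionOfSingularities.Theorems.FInjectiveMacaulayfication
open SliceableCentre

/-! ## §1 Integral form -/

/-- **THE DIM-4 SLICE OF THE CRUX ⟸ CP package ∧ (L4♭)** (integral form = RHS of `Reductions.fInjectiveMacaulayfication_iff_integral` for every
`X` of dimension `≤ 4`). [OURS · conditional on the CANDIDATE (L4♭) and on CP 1.1 / R–G / CP 4.4 BY NAME]
[cite: CossartPiltant2019, Thm. 1.1; Prop. 4.4] [cite: Temkin2008, Prop. 2.3.4] -/
theorem fiModel_integral_dimLe4_of_L4fibre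
    (hG : CossartPiltant2019General.{0}) (h081R : Stacks081R.{0}) (hP : CossartPiltant2019Principalization.{0})
    (hL4 : LocalFullificationDimFourFibre.LocalFullificationDimFourFibre)
    (p : ℕ) [hp : Fact p.Prime] (k : Type) [Field k] [CharP k p] (X : Scheme.{0}) (f : X ⟶ Spec (.of k))
    [IsSeparated f] [LocallyOfFiniteType f] [QuasiCompact f] [IsIntegral X] (h4 : topologicalKrullDim X ≤ 4) :
    ∃ (X' : Scheme.{0}) (π : X' ⟶ X), IsProper π ∧ IsBirational π ∧ IsIntegral X' ∧ ∀ x : X', FullCl p (X'.presheaf.stalk x) := by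
  classical
  refine FInjectiveMacaulayficationDimFour.fiModel_integral_dimLe4_of_step hG h081R hP p k X f h4 ?_
  intro X' g J F hg hJ _ hFfin hFpts hFdim hreg
  haveI : IsLocallyNoetherian X := LocallyOfFiniteType.isLocallyNoetherian f
  -- `F ≠ ∅` forces `dim X = 4` (a point of local dimension 4 in a variety of dimension ≤ 4); `F = ∅`: `X'` is already regular, hence FULL
  by_cases hF0 : F = ∅
  · subst hF0
    have hJne : J ≠ ⊥ := by
      intro h0
      have hgen : genericPoint X ∈ (J.support : Set X) := by rw [h0, Scheme.IdealSheafData.support_bot]; trivial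
      have := hJ hgen
      rw [Set.mem_compl_iff, Scheme.mem_regularLocus] at this
      exact this (inferInstanceAs (IsRegularLocalRing X.functionField))
    refine ⟨X', g, J, hJne, hg, fun x' => ?_⟩
    have hx' : x' ∈ Scheme.regularLocus X' := hreg x' (by simp)
    rw [Scheme.mem_regularLocus] at hx'
    haveI := hx'
    haveI := FTemkinClosedPoints.charP_stalk_of_over p f g x'
    exact FTemkinClosedPoints.fullCl_of_isRegularLocalRing p _
  · obtain ⟨b, hb⟩ := Set.nonempty_iff_ne_empty.mpr hF0
    have h4' : topologicalKrullDim X = 4 := by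
      refine le_antisymm h4 ?_
      have hb4 := hFdim b hb
      calc (4 : WithBot ℕ∞) = ringKrullDim (X.presheaf.stalk b) := hb4.symm
        _ ≤ topologicalKrullDim X := by
          rw [ringKrullDim_stalk_eq_coheight]
          refine le_trans ?_ (Literature.AlgebraicGeometry.Dimension.height_add_coheight_le_topologicalKrullDim b)
          exact WithBot.coe_le_coe.mpr le_add_self
    obtain ⟨X'', f'', J'', hf'', hJ'', -, hfull⟩ :=
      FTemkinClosedPointsFibre.full_model_of_regularOffFinite_of_L4fibre (fun q hq => hL4 q hq) p hp.out k X f h4' X' g J hg hJ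
        hFfin.toFinset (fun b hb => hFpts b (hFfin.mem_toFinset.mp hb))
        fun x' hx' => (Scheme.mem_regularLocus _).mp (hreg x' fun h => hx' (hFfin.mem_toFinset.mpr h))
    exact ⟨X'', f'', J'', hJ'', hf'', hfull⟩

/-! ## §2 The crux's own ∀-text on `dim X ≤ 4` (reduced `X`) -/

/-- **The crux's conclusion for a given reduced `X` of dimension `≤ 4`** (instance-binder form), modulo the threefold package and (L4♭).
[OURS · conditional-result] [cite: CossartPiltant2019, Thm. 1.1 (i)(ii); Prop. 4.4] [cite: Temkin2008, Prop. 2.3.4] -/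
theorem exists_fiModel_dimLe4_of_L4fibre
    (hG : CossartPiltant2019General.{0}) (h081R : Stacks081R.{0}) (hP : CossartPiltant2019Principalization.{0})
    (hL4 : LocalFullificationDimFourFibre.LocalFullificationDimFourFibre)
    (p : ℕ) [Fact p.Prime] (k : Type) [Field k] [CharP k p] (X : Scheme.{0}) (f : X ⟶ Spec (.of k))
    [IsSeparated f] [LocallyOfFiniteType f] [QuasiCompact f] [IsReduced X] (h4 : topologicalKrullDim X ≤ 4) :
    ∃ (X' : Scheme.{0}) (π : X' ⟶ X), IsProper π ∧ IsBirational π ∧ ∀ x : X',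
      IsDomain (X'.presheaf.stalk x) ∧ ∀ d : ℕ, ringKrullDim (X'.presheaf.stalk x) = d →
        ∀ s : Fin d → X'.presheaf.stalk x, (Ideal.span (Set.range s)).radical.IsMaximal →
          RingTheory.Sequence.IsWeaklyRegular (X'.presheaf.stalk x) (List.ofFn s) ∧
          ∀ y : X'.presheaf.stalk x, (∃ e : ℕ, y ^ p ^ e ∈ Ideal.span
            ((fun z : X'.presheaf.stalk x => z ^ p ^ e) ''
              (Ideal.span (Set.range s) : Set (X'.presheaf.stalk x)))) →
            y ∈ Ideal.span (Set.range s) := by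
  refine exists_model_of_forall_closeds
    (fun Y : Scheme.{0} => ∀ y : Y, IsDomain (Y.presheaf.stalk y) ∧
      ∀ d : ℕ, ringKrullDim (Y.presheaf.stalk y) = d →
        ∀ s : Fin d → Y.presheaf.stalk y, (Ideal.span (Set.range s)).radical.IsMaximal →
          RingTheory.Sequence.IsWeaklyRegular (Y.presheaf.stalk y) (List.ofFn s) ∧
          ∀ w : Y.presheaf.stalk y, (∃ e : ℕ, w ^ p ^ e ∈ Ideal.span
            ((fun z : Y.presheaf.stalk y => z ^ p ^ e) ''
              (Ideal.span (Set.range s) : Set (Y.presheaf.stalk y)))) →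
            w ∈ Ideal.span (Set.range s))
    (fun Y hY y => (hY.false y).elim) (fun U V hU hV => fiClause_coprod p hU hV) X f fun Z hZ => ?_
  haveI := hZ
  have hdimZ : topologicalKrullDim (Scheme.IdealSheafData.vanishingIdeal Z).subscheme ≤ 4 :=
    (DimLe4Reduced.topologicalKrullDim_subscheme_vanishingIdeal_le Z).trans h4
  obtain ⟨X', π, hprop, hbir, -, hfi⟩ :=
    fiModel_integral_dimLe4_of_L4fibre hG h081R hP hL4 p k _ ((Scheme.IdealSheafData.vanishingIdeal Z).subschemeι ≫ f) hdimZ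
  exact ⟨X', π, hprop, hbir, hfi⟩

/-- **★ THE CRUX RESTRICTED TO DIMENSION ≤ 4, FROM (L4♭).** The ∀-text of
`Summit.ResolutionOfSingularities.ResolutionOfSingularities.Theses.FrobeniusLadder.FInjectiveMacaulayfication` VERBATIM with the single extra
binder `topologicalKrullDim X ≤ 4`, modulo {CP 2019 Thm. 1.1, Raynaud–Gruson 5.2.2, CP 2019 Prop. 4.4} BY NAME and the candidate (L4♭)
`LocalFullificationDimFourFibre` (fibre-supported local FULL-ification in dimension 4; weaker than (L4)).
[OURS · conditional-result] [cite: CossartPiltant2019, Thm. 1.1 (i)(ii); Prop. 4.4] [cite: Temkin2008, Prop. 2.3.4] -/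
theorem fInjectiveMacaulayfication_dimLe4_of_L4fibre
    (hG : CossartPiltant2019General.{0}) (h081R : Stacks081R.{0}) (hP : CossartPiltant2019Principalization.{0})
    (hL4 : LocalFullificationDimFourFibre.LocalFullificationDimFourFibre) :
    ∀ p : ℕ, p.Prime → ∀ (k : Type) [Field k] [CharP k p] (X : Scheme.{0}) (f : X ⟶ Spec (.of k)),
      IsSeparated f → LocallyOfFiniteType f → QuasiCompact f → IsReduced X → topologicalKrullDim X ≤ 4 →
      ∃ (X' : Scheme.{0}) (π : X' ⟶ X), IsProper π ∧ IsBirational π ∧ ∀ x : X',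
        IsDomain (X'.presheaf.stalk x) ∧ ∀ d : ℕ, ringKrullDim (X'.presheaf.stalk x) = d →
          ∀ s : Fin d → X'.presheaf.stalk x, (Ideal.span (Set.range s)).radical.IsMaximal →
            RingTheory.Sequence.IsWeaklyRegular (X'.presheaf.stalk x) (List.ofFn s) ∧
            ∀ y : X'.presheaf.stalk x, (∃ e : ℕ, y ^ p ^ e ∈ Ideal.span
              ((fun z : X'.presheaf.stalk x => z ^ p ^ e) ''
                (Ideal.span (Set.range s) : Set (X'.presheaf.stalk x)))) →
              y ∈ Ideal.span (Set.range s) := by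
  intro p hp k _ _ X f hsep hft hqc hred h4
  haveI : Fact p.Prime := ⟨hp⟩
  haveI := hsep
  haveI := hft
  haveI := hqc
  haveI := hred
  exact exists_fiModel_dimLe4_of_L4fibre hG h081R hP hL4 p k X f h4

end Summit.ResolutionOfSingularities.ResolutionOfSingularities.Theorems.FInjectiveMacaulayfication.DimLe4OfL4Fibre

end
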